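import Literature.RingTheory.KTheory.MilnorKSumOfSquares
import Mathlib.LinearAlgebra.TensorAlgebra.Basic
import Mathlib.Algebra.RingQuot
import Mathlib.Data.List.Duplicate
import HarnessLib

/-!
# The ring `K_*F = T(K₁F)/⟨l(a) ⊗ l(1−a)⟩` and THEOREM 1.4: `−1` is a sum of squares iff every positive-dimensional
# element of `K_*F` is nilpotent (Milnor, *Algebraic K-theory and quadratic forms*, Invent. Math. 9 (1970), §1)

Family `hodge`, lane `lit-hodgefound` (foundations library; seat `lit-hodgefound-p27`, generation 40, row g40-#7);
topic `RingTheory/KTheory`.  Sequel of `MilnorKGroups` (g39-#12: the groups `K_nR = MilnorK R n`, `symbol`, `lift`,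
Lemma 1.1 `symbol_comp_swap`, Lemma 1.2 `symbol_eq_of_eq_self`), `MilnorKRing` (g39-#14: the products
`mul R m n : K_m × K_n → K_{m+n}`), `MilnorKSumOfSquares` (g40-#4: `l(−1)^{r+1} = 0 ∈ K_{r+1}F` when `−1` is a sum of `r`
squares, `exists_symbol_neg_one_eq_zero`; the total preordering of a field in which `−1` is not a sum of squares,
`exists_total_ringPreordering`, and its sign bits `sgnBit`, `sgnBitHom`) and `MilnorKNilpotent` (g40-#6: Theorem 1.4 for
generators inside the groups `K_nF`); Mathlib's `TensorAlgebra`, `RingQuot`, `MultilinearMap.mkPiAlgebraFin`.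
DEFINITIONS WITH BODIES (`MilnorKStar.rel`, the `abbrev MilnorKStar`, `gen`, `l`, `prodMultilinear`, `ofDeg`, `aug`,
`word`, `wordsFrom`, `wordSpan`, `posDim`, `eps`, `signChar`) and PROVED THEOREMS; no named fact, no instance (the ring
and `ℤ`-algebra structures of `K_*R` are Mathlib's `RingQuot` instances, reached through the `abbrev`), no notation,
0 `sorry`, net debt 0 (D-0026).

## The source, verbatim

J. Milnor, *Algebraic K-theory and quadratic forms*, Invent. Math. 9 (1970) 318–344 (held `paper:doi-10-1007-bf01425486`;
bib key `Milnor1970`), §1 (p0001 L31 – p0002 L20): «To any field F we associate a graded ring K_*F = (K₀F, K₁F, K₂F, …)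
as follows. By definition, K₁F is just the multiplicative group F• written additively. […] l(ab) = l(a) + l(b). Then
K_*F is defined to be the quotient of the tensor algebra (ℤ, K₁F, K₁F ⊗ K₁F, …) by the ideal generated by all
l(a) ⊗ l(1−a) with a ≠ 0, 1. In other words each K_nF, n ≥ 2, is the quotient of the n-fold tensor product
K₁F ⊗ ⋯ ⊗ K₁F by the subgroup generated by all l(a₁) ⊗ ⋯ ⊗ l(aₙ) such that aᵢ + aᵢ₊₁ = 1 for some i. In terms of
generators and relations, K_*F can be described as the associative ring with unit which is generated by symbols l(a),
a ∈ F•, subject only to the defining relations l(ab) = l(a) + l(b) and l(a)l(1−a) = 0.»  And (p0003 L21–L52):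
«**THEOREM 1.4.** The element −1 is a sum of squares in F if and only if every positive dimensional element of K_*F is
nilpotent. *Proof.* If −1 is not a sum of squares, then F can be embedded in a real closed field, and hence can be
ordered. Choosing some fixed ordering, define an n-linear mapping from K₁F × ⋯ × K₁F to the integers modulo 2 by the
correspondence l(a₁) × ⋯ × l(aₙ) ↦ (1 − sgn a₁)/2 ⋯ (1 − sgn aₙ)/2. Evidently the right hand side is zero whenever
aᵢ + aᵢ₊₁ = 1. Hence this correspondence induces a homomorphism K_nF → ℤ/2ℤ; which carries l(−1)ⁿ to 1. This proves
that the element l(−1) is not nilpotent. Conversely, if say −1 = a₁² + ⋯ + a_r², then it follows from 1.3 that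
l(−a₁²)⋯l(−a_r²) = 0; hence l(−1)^r ≡ 0 mod 2K_rF. Since 2l(−1) = 0, it follows immediately that l(−1)^{r+1} = 0. For
any generator γ = l(a₁)⋯l(aₙ) of the group K_nF, it follows from 1.2 that γ^s is equal to a multiple of
l(−1)^{n(s−1)}. Hence γ^s = 0 whenever n(s−1) > r. Similarly, for any sum γ₁ + ⋯ + γ_k of generators, the power
(γ₁ + ⋯ + γ_k)^s can be expressed as a linear combination of monomials γ₁^{i₁}⋯γ_k^{i_k} with i₁ + ⋯ + i_k = s.
Choosing s > k, note that each such monomial is a multiple of l(−1)^{n(s−k)}. If s > k + r/n, it follows that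
(γ₁ + ⋯ + γ_k)^s = 0; which completes the proof.»

## What is formalised

* §1 **the ring `K_*R`** for a commutative ring `R`, exactly as printed: `MilnorKStar R := RingQuot (MilnorKStar.rel R)`,
  the tensor algebra `TensorAlgebra ℤ (Additive Rˣ)` of `K₁R` modulo (the two-sided ideal generated by) the Steinberg
  relation `ι l(a) · ι l(b) ∼ 0`, `a + b = 1`; the generators `l R a` with **`l_mul : l(ab) = l(a) + l(b)`** and
  **`l_mul_l_eq_zero : l(a)l(1−a) = 0`**; the canonical maps **`ofDeg R n : K_nR →+ K_*R`**,
  `{a₁, …, aₙ} ↦ l(a₁)⋯l(aₙ)` («in other words»: `MilnorK.lift` of the ordered-product multilinear map, well defined by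
  `l(aᵢ)l(aᵢ₊₁) = 0`), **`ofDeg_mul`** (the products `MilnorK.mul` of `MilnorKRing` are the restrictions of the ring
  product), `ofDeg_one`; the augmentation **`aug R : K_*R →ₐ[ℤ] ℤ = K₀R`** (`aug_l = 0`, `aug_ofDeg_succ = 0`,
  `aug_ofDeg_zero = zeroEquiv`).
* §2 monomials: `word R [a₁, …, a_k] = l(a₁)⋯l(a_k)` (`= ofDeg {a₁, …, a_k}`, `word_eq_ofDeg`), the subgroups
  `wordSpan R L t = S_t(L)` generated by the monomials of length `≥ t` in the letters of a finite set `L`,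
  **`mul_mem_wordSpan : S_t(L)·S_u(L) ⊆ S_{t+u}(L)`**, `pow_mem_wordSpan`, **`exists_mem_wordSpan`** (every element of
  `K_*R` is a `ℤ`-combination of monomials in finitely many letters — induction over the tensor algebra),
  `mem_wordSpan_one_of_aug_eq_zero`; the positive-dimensional part **`posDim R = ⨆ₙ range (ofDeg (n+1))`** with
  **`mem_posDim_iff : x ∈ posDim ↔ aug x = 0`**, and `iSup_range_ofDeg : ⨆ₙ range (ofDeg n) = ⊤` (`K_*R` is generated by
  its homogeneous components).
* §3 over a field: `eps F = l(−1)`, «2l(−1) = 0» `eps_add_eps`; LEMMA 1.1 **`l_mul_l_add : l(a)l(b) + l(b)l(a) = 0`** and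
  LEMMA 1.2 **`l_mul_self : l(a)² = l(a)l(−1)`**, both transported from `K₂F` along `ofDeg 2`; **`eps_comm`** (`l(−1)` is
  central); the monomial calculus of the proof: **`l_mul_word_of_mem`** (`l(a)·w = l(−1)·w` if `a` occurs in `w`),
  `word_of_not_nodup`, **`word_eq_eps_pow_mul`** («each such monomial is a multiple of l(−1)^{s−k}»: length `≥ |L| + j`
  forces `j` repetitions), `word_eq_zero_of_eps_pow`, `exists_eps_pow_eq_zero` (`l(−1)^{r+1} = 0` in `K_*F`);
  **`isNilpotent_of_aug_eq_zero`** (THEOREM 1.4 `⇒`); the sign character **`signChar P : K_*F →ₐ[ℤ] ℤ/2`** of a total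
  preordering, `signChar_eps = 1`, **`isSumSq_of_isNilpotent_eps`** (THEOREM 1.4 `⇐`); and **THEOREM 1.4
  `isSumSq_neg_one_iff_isNilpotent : IsSumSq (−1 : F) ↔ ∀ x : K_*F, aug x = 0 → IsNilpotent x`**, also as
  `isSumSq_neg_one_iff_isNilpotent' : … ↔ ∀ x ∈ posDim F, IsNilpotent x`.

All sign bookkeeping of the printed proof («a multiple of l(−1)^{n(s−k)}», up to sign) disappears here because
`2l(−1) = 0` makes `−l(−1)y = l(−1)y`; accordingly every identity is stated additively (e.g. Lemma 1.1 as
`l(a)l(b) + l(b)l(a) = 0`), which also keeps the statements clear of the `RingQuot`-specific negation instance.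

Not here: the injectivity of `ofDeg R n` (that `K_*R ≅ ⊕ₙ K_nR` as graded groups, i.e. that the ideal is homogeneous —
the «in other words» of the source); only the generation statements `iSup_range_ofDeg`, `mem_posDim_iff` are proved.

## References

* [Milnor1970] J. Milnor, *Algebraic K-theory and quadratic forms*, Invent. Math. 9 (1970) 318–344 — §1: the ring
  `K_*F` (p0001 L31 – p0002 L20), Lemma 1.1 (p0002 L33–L45), Lemma 1.2 (p0002 L48–L50), Theorem 1.4 and its proof
  (p0003 L21–L52).

Provenance: lane `lit-hodgefound`, seat `lit-hodgefound-p27` gen 40 (agent `literature-prover-lit-hodgefound-p27-g40-0`),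
row g40-#7.
-/

set_option autoImplicit false

noncomputable section

namespace Literature.RingTheory.KTheory

open Function

section Ring

variable (R : Type*) [CommRing R]

/-- The Steinberg relation on the tensor algebra `T(K₁R) = TensorAlgebra ℤ (Additive Rˣ)` of `K₁R = Rˣ` (written
additively): `l(a) ⊗ l(b) ∼ 0` whenever `a + b = 1`. [cite: Milnor1970, §1 «K_*F is defined to be the quotient of the tensor algebra (ℤ, K₁F, K₁F ⊗ K₁F, …) by the ideal generated by all l(a) ⊗ l(1−a)» (p0002 L5–L15)] -/
def MilnorKStar.rel (x y : TensorAlgebra ℤ (Additive Rˣ)) : Prop :=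
  ∃ a b : Rˣ, (a : R) + b = 1 ∧
    x = TensorAlgebra.ι ℤ (Additive.ofMul a) * TensorAlgebra.ι ℤ (Additive.ofMul b) ∧ y = 0

/-- **Milnor's ring `K_*R`**: «the quotient of the tensor algebra (ℤ, K₁R, K₁R ⊗ K₁R, …) by the ideal generated by all
l(a) ⊗ l(1 − a)» — Mathlib's `RingQuot` of the tensor algebra of `K₁R = Additive Rˣ` over `ℤ` by the Steinberg
relation `MilnorKStar.rel` (the two-sided ideal it generates).  An `abbrev`, so that the ring and `ℤ`-algebra structures
of `RingQuot` apply; no instance is declared.  (The groups `MilnorK R n` of `MilnorKGroups` are its homogeneous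
components «in other words»; the canonical maps are `ofDeg` below.) [cite: Milnor1970, §1, the definition of K_*F (p0002 L5–L15)] -/
abbrev MilnorKStar : Type _ := RingQuot (MilnorKStar.rel R)

namespace MilnorKStar

/-- The canonical additive map `K₁R → K_*R` (the composite `K₁R = Additive Rˣ →ι T(K₁R) → K_*R`). [cite: Milnor1970, §1, the definition of K_*F (p0002 L5–L15)] -/
def gen : Additive Rˣ →+ MilnorKStar R :=
  (RingQuot.mkAlgHom ℤ (MilnorKStar.rel R)).toAddMonoidHom.comp (TensorAlgebra.ι ℤ).toAddMonoidHom

/-- **`l(a) ∈ K_*R`** for a unit `a`: «generated by symbols l(a), a ∈ F•». [cite: Milnor1970, §1 «K_*F can be described as the associative ring with unit which is generated by symbols l(a), a ∈ F•, subject only to the defining relations l(ab) = l(a) + l(b) and l(a)l(1−a) = 0» (p0002 L18–L20)] -/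
def l (a : Rˣ) : MilnorKStar R := gen R (Additive.ofMul a)

/-- `gen` unfolded. [cite: Milnor1970, §1, the definition of K_*F (p0002 L5–L15)] -/
theorem gen_apply (x : Additive Rˣ) : gen R x = RingQuot.mkAlgHom ℤ (MilnorKStar.rel R) (TensorAlgebra.ι ℤ x) := rfl

/-- `l(a)` unfolded: the class of `ι(l(a)) ∈ T(K₁R)`. [cite: Milnor1970, §1, the definition of K_*F (p0002 L5–L15)] -/
theorem l_def (a : Rˣ) :
    l R a = RingQuot.mkAlgHom ℤ (MilnorKStar.rel R) (TensorAlgebra.ι ℤ (Additive.ofMul a)) := rfl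

/-- **The defining relation `l(ab) = l(a) + l(b)`.** [cite: Milnor1970, §1, K_*F by generators and relations (p0002 L18–L20)] -/
theorem l_mul (a b : Rˣ) : l R (a * b) = l R a + l R b := by
  rw [l, ofMul_mul, map_add]; rfl

/-- `l(1) = 0`. [cite: Milnor1970, §1, K_*F by generators and relations (p0002 L18–L20)] -/
theorem l_one : l R 1 = 0 := by rw [l, ofMul_one, map_zero]

/-- **The defining relation `l(a) l(1 − a) = 0`** (here: `l(a) l(b) = 0` whenever `a + b = 1`). [cite: Milnor1970, §1, K_*F by generators and relations (p0002 L18–L20)] -/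
theorem l_mul_l_eq_zero {a b : Rˣ} (h : (a : R) + b = 1) : l R a * l R b = 0 := by
  have hrel : MilnorKStar.rel R (TensorAlgebra.ι ℤ (Additive.ofMul a) * TensorAlgebra.ι ℤ (Additive.ofMul b)) 0 :=
    ⟨a, b, h, rfl, rfl⟩
  rw [l_def, l_def, ← map_mul, RingQuot.mkAlgHom_rel ℤ hrel, map_zero]

/-- The multilinear map `(x₁, …, xₙ) ↦ l(x₁)⋯l(xₙ) ∈ K_*R` on `(K₁R)ⁿ` (Mathlib's `MultilinearMap.mkPiAlgebraFin` composed with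
`gen` in each slot). [cite: Milnor1970, §1 «In other words each K_nF, n ≥ 2, is the quotient of the n-fold tensor product K₁F ⊗ ⋯ ⊗ K₁F by the subgroup generated by all l(a₁) ⊗ ⋯ ⊗ l(aₙ) such that aᵢ + aᵢ₊₁ = 1 for some i» (p0002 L15–L18)] -/
def prodMultilinear (n : ℕ) : MultilinearMap ℤ (fun _ : Fin n => Additive Rˣ) (MilnorKStar R) :=
  (MultilinearMap.mkPiAlgebraFin ℤ n (MilnorKStar R)).compLinearMap fun _ => (gen R).toIntLinearMap

/-- Its value: the ordered product `l(a₁)⋯l(aₙ)`. [cite: Milnor1970, §1 «In other words each K_nF, n ≥ 2, is the quotient of the n-fold tensor product …» (p0002 L15–L18)] -/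
theorem prodMultilinear_apply (n : ℕ) (a : Fin n → Rˣ) :
    prodMultilinear R n (fun j => Additive.ofMul (a j)) = (List.ofFn fun j => l R (a j)).prod := rfl

/-- An ordered product two adjacent factors of which multiply to zero vanishes. [folklore] -/
private theorem prod_ofFn_eq_zero {M : Type*} [MonoidWithZero M] :
    ∀ {n : ℕ} (f : Fin n → M) (i : Fin n) (h : i.val + 1 < n), f i * f ⟨i.val + 1, h⟩ = 0 → (List.ofFn f).prod = 0
  | 0, _, i, _, _ => Fin.elim0 i
  | n + 1, f, i, h, hf => by
    rw [List.ofFn_succ, List.prod_cons]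
    rcases Fin.eq_zero_or_eq_succ i with rfl | ⟨i', rfl⟩
    · cases n with
      | zero => simp at h
      | succ n =>
        rw [List.ofFn_succ, List.prod_cons, ← mul_assoc]
        have h1 : (⟨(0 : Fin (n + 2)).val + 1, h⟩ : Fin (n + 2)) = (0 : Fin (n + 1)).succ := Fin.ext (by simp)
        rw [h1] at hf
        rw [hf, zero_mul]
    · have h' : i'.val + 1 < n := by simpa using h
      have h1 : (⟨(i'.succ).val + 1, h⟩ : Fin (n + 1)) = (⟨i'.val + 1, h'⟩ : Fin n).succ := Fin.ext (by simp)
      rw [h1] at hf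
      rw [prod_ofFn_eq_zero (fun j => f j.succ) i' h' hf, mul_zero]

/-- **The canonical maps `K_nR → K_*R`, `{a₁, …, aₙ} ↦ l(a₁)⋯l(aₙ)`** — well defined because a generator
`l(a₁) ⊗ ⋯ ⊗ l(aₙ)` with `aᵢ + aᵢ₊₁ = 1` maps to a product containing the factor `l(aᵢ)l(aᵢ₊₁) = 0` («In other words each
K_nF, n ≥ 2, is the quotient of the n-fold tensor product […] by the subgroup generated by all l(a₁) ⊗ ⋯ ⊗ l(aₙ) such
that aᵢ + aᵢ₊₁ = 1 for some i»; `MilnorK.lift` of `prodMultilinear`). [cite: Milnor1970, §1 «In other words each K_nF, n ≥ 2, is the quotient of the n-fold tensor product …» (p0002 L15–L18)] -/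
def ofDeg (n : ℕ) : MilnorK R n →+ MilnorKStar R :=
  MilnorK.lift (prodMultilinear R n) (by
    intro a i h hsum
    rw [prodMultilinear_apply]
    exact prod_ofFn_eq_zero _ i h (l_mul_l_eq_zero R hsum))

/-- `ofDeg {a₁, …, aₙ} = l(a₁)⋯l(aₙ)`. [cite: Milnor1970, §1 «In other words each K_nF, n ≥ 2, is the quotient of the n-fold tensor product …» (p0002 L15–L18)] -/
theorem ofDeg_symbol {n : ℕ} (a : Fin n → Rˣ) : ofDeg R n (MilnorK.symbol a) = (List.ofFn fun j => l R (a j)).prod := by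
  rw [ofDeg, MilnorK.lift_symbol, prodMultilinear_apply]

/-- `ofDeg {a, …, a} = l(a)ⁿ`; in particular `ofDeg (l(−1)ⁿ ∈ K_nR) = l(−1)ⁿ ∈ K_*R`. [cite: Milnor1970, §1 «In other words each K_nF, n ≥ 2, is the quotient of the n-fold tensor product …» (p0002 L15–L18)] -/
theorem ofDeg_symbol_const (n : ℕ) (a : Rˣ) : ofDeg R n (MilnorK.symbol fun _ : Fin n => a) = l R a ^ n := by
  rw [ofDeg_symbol, List.ofFn_const, List.prod_replicate]

/-- `ofDeg` carries the unit `{} ∈ K₀R` to `1`. [cite: Milnor1970, §1 «a graded ring K_*F = (K₀F, K₁F, K₂F, …)» (p0001 L31–L33)] -/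
theorem ofDeg_one : ofDeg R 0 MilnorK.one = 1 := by
  rw [MilnorK.one, ofDeg_symbol]; rfl

/-- In degree `1`, `ofDeg {a} = l(a)`. [cite: Milnor1970, §1 «a graded ring K_*F = (K₀F, K₁F, K₂F, …)» (p0001 L31–L33)] -/
theorem ofDeg_one_symbol (a : Fin 1 → Rˣ) : ofDeg R 1 (MilnorK.symbol a) = l R (a 0) := by
  rw [ofDeg_symbol]; simp

/-- In degree `2`, `ofDeg {a, b} = l(a)l(b)`. [cite: Milnor1970, §1 «a graded ring K_*F = (K₀F, K₁F, K₂F, …)» (p0001 L31–L33)] -/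
theorem ofDeg_two_symbol (a : Fin 2 → Rˣ) : ofDeg R 2 (MilnorK.symbol a) = l R (a 0) * l R (a 1) := by
  rw [ofDeg_symbol]; simp

/-- Post-composition commutes with `Fin.append`. [folklore] -/
private theorem comp_append {α β : Type*} {m n : ℕ} (g : α → β) (u : Fin m → α) (v : Fin n → α) :
    (fun k => g (Fin.append u v k)) = Fin.append (fun i => g (u i)) (fun j => g (v j)) := by
  funext k
  refine Fin.addCases (fun i => ?_) (fun j => ?_) k
  · rw [Fin.append_left, Fin.append_left]
  · rw [Fin.append_right, Fin.append_right]

/-- **Multiplicativity: the products `K_mR × K_nR → K_{m+n}R` of `MilnorKRing` are the restrictions of the product of the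
ring `K_*R`**, `ofDeg (ξ·η) = ofDeg ξ · ofDeg η` (on symbols: `{a}{b} = {a, b} ↦ l(a₁)⋯l(a_m) · l(b₁)⋯l(bₙ)`). [cite: Milnor1970, §1 «a graded ring K_*F = (K₀F, K₁F, K₂F, …)» (p0001 L31–L33)] -/
theorem ofDeg_mul {m n : ℕ} (x : MilnorK R m) (y : MilnorK R n) :
    ofDeg R (m + n) (MilnorK.mul R m n x y) = ofDeg R m x * ofDeg R n y := by
  suffices h : (AddMonoidHom.compHom (ofDeg R (m + n))).comp (MilnorK.mul R m n) =
      (AddMonoidHom.mul.comp (ofDeg R m)).compl₂ (ofDeg R n) by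
    simpa using congrArg (fun φ => φ x y) h
  refine MilnorK.hom_ext₂ (fun a b => ?_)
  simp only [AddMonoidHom.comp_apply, AddMonoidHom.compHom_apply_apply, AddMonoidHom.compl₂_apply,
    AddMonoidHom.mul_apply, MilnorK.mul_symbol_symbol, ofDeg_symbol]
  rw [comp_append (l R), List.ofFn_fin_append, List.prod_append]

/-! ### the augmentation `K_*R → K₀R = ℤ` -/

/-- **The augmentation `K_*R → K₀R = ℤ`**, the ring homomorphism killing every `l(a)` (the projection of the graded
ring onto its degree-`0` component; `RingQuot.liftAlgHom` of `TensorAlgebra.lift 0`). [cite: Milnor1970, §1 «a graded ring K_*F = (K₀F, K₁F, K₂F, …)» (p0001 L31–L33)] -/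
def aug : MilnorKStar R →ₐ[ℤ] ℤ :=
  RingQuot.liftAlgHom ℤ ⟨TensorAlgebra.lift ℤ (0 : Additive Rˣ →ₗ[ℤ] ℤ), by
    rintro x y ⟨a, b, -, rfl, rfl⟩
    rw [map_mul, TensorAlgebra.lift_ι_apply, LinearMap.zero_apply, zero_mul, map_zero]⟩

/-- `aug (l(a)) = 0`. [cite: Milnor1970, §1 «a graded ring K_*F = (K₀F, K₁F, K₂F, …)» (p0001 L31–L33)] -/
theorem aug_l (a : Rˣ) : aug R (l R a) = 0 := by
  rw [l_def, aug, RingQuot.liftAlgHom_mkAlgHom_apply, TensorAlgebra.lift_ι_apply, LinearMap.zero_apply]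

/-- `aug 1 = 1`. [cite: Milnor1970, §1 «a graded ring K_*F = (K₀F, K₁F, K₂F, …)» (p0001 L31–L33)] -/
theorem aug_one : aug R 1 = 1 := map_one _

/-- `aug` is the identity on `K₀R = ℤ ⊂ K_*R`. [cite: Milnor1970, §1 «a graded ring K_*F = (K₀F, K₁F, K₂F, …)» (p0001 L31–L33)] -/
theorem aug_algebraMap (c : ℤ) : aug R (algebraMap ℤ (MilnorKStar R) c) = c := by
  rw [AlgHom.commutes, eq_intCast, Int.cast_id]

/-- `aug` kills the images of the `K_nR`, `n ≥ 1`. [cite: Milnor1970, §1 «a graded ring K_*F = (K₀F, K₁F, K₂F, …)» (p0001 L31–L33)] -/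
theorem aug_ofDeg_succ {n : ℕ} (x : MilnorK R (n + 1)) : aug R (ofDeg R (n + 1) x) = 0 := by
  suffices h : (aug R).toRingHom.toAddMonoidHom.comp (ofDeg R (n + 1)) = 0 from congrArg (fun φ => φ x) h
  refine MilnorK.hom_ext (fun a => ?_)
  change aug R (ofDeg R (n + 1) (MilnorK.symbol a)) = 0
  rw [ofDeg_symbol, List.ofFn_succ, List.prod_cons, map_mul, aug_l, zero_mul]

/-- On the image of `K₀R`, `aug` is the identification `K₀R = ℤ` (`MilnorK.zeroEquiv`). [cite: Milnor1970, §1 «a graded ring K_*F = (K₀F, K₁F, K₂F, …)» (p0001 L31–L33)] -/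
theorem aug_ofDeg_zero (x : MilnorK R 0) : aug R (ofDeg R 0 x) = MilnorK.zeroEquiv R x := by
  suffices h : (aug R).toRingHom.toAddMonoidHom.comp (ofDeg R 0) = (MilnorK.zeroEquiv R).toAddMonoidHom from
    congrArg (fun φ => φ x) h
  refine MilnorK.hom_ext (fun a => ?_)
  change aug R (ofDeg R 0 (MilnorK.symbol a)) = MilnorK.zeroEquiv R (MilnorK.symbol a)
  rw [ofDeg_symbol, MilnorK.zeroEquiv_symbol, List.ofFn_zero, List.prod_nil, map_one]

/-! ### words -/

/-- The monomial `l(a₁) l(a₂) ⋯ l(a_k) ∈ K_*R` of a list of units («monomials γ₁^{i₁}⋯γ_k^{i_k}»). [cite: Milnor1970, §1 proof of Theorem 1.4 «Similarly, for any sum γ₁ + ⋯ + γ_k of generators, the power (γ₁ + ⋯ + γ_k)^s can be expressed as a linear combination of monomials […] Choosing s > k, note that each such monomial is a multiple of l(−1)^{n(s−k)}. If s > k + r/n, it follows that (γ₁ + ⋯ + γ_k)^s = 0» (p0003 L49–L52)] -/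
def word (w : List Rˣ) : MilnorKStar R := (w.map (l R)).prod

/-- The empty monomial is `1`. [cite: Milnor1970, §1 proof of Theorem 1.4, the clause for sums of generators (p0003 L49–L52)] -/
theorem word_nil : word R [] = 1 := rfl

/-- `l(a₁)⋯l(a_k) = l(a₁) · (l(a₂)⋯l(a_k))`. [cite: Milnor1970, §1 proof of Theorem 1.4, the clause for sums of generators (p0003 L49–L52)] -/
theorem word_cons (a : Rˣ) (w : List Rˣ) : word R (a :: w) = l R a * word R w := by
  rw [word, List.map_cons, List.prod_cons]; rfl

/-- The monomial of one letter is `l(a)`. [cite: Milnor1970, §1 proof of Theorem 1.4, the clause for sums of generators (p0003 L49–L52)] -/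
theorem word_singleton (a : Rˣ) : word R [a] = l R a := by rw [word_cons, word_nil, mul_one]

/-- Monomials multiply by concatenation. [cite: Milnor1970, §1 proof of Theorem 1.4, the clause for sums of generators (p0003 L49–L52)] -/
theorem word_append (u v : List Rˣ) : word R (u ++ v) = word R u * word R v := by
  rw [word, List.map_append, List.prod_append]; rfl

/-- A monomial of length `k` is the image of the symbol `{a₁, …, a_k} ∈ K_kR`. [cite: Milnor1970, §1 «In other words each K_nF, n ≥ 2, is the quotient of the n-fold tensor product …» (p0002 L15–L18)] -/
theorem word_eq_ofDeg (w : List Rˣ) : word R w = ofDeg R w.length (MilnorK.symbol fun j => w.get j) := by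
  rw [ofDeg_symbol, word]
  congr 1
  conv_lhs => rw [← List.ofFn_get (l := w), List.map_ofFn]
  rfl

/-- Non-empty monomials are positive-dimensional: `aug (l(a₁)⋯l(a_k)) = 0` for `k ≥ 1`. [cite: Milnor1970, §1 «a graded ring K_*F = (K₀F, K₁F, K₂F, …)» (p0001 L31–L33)] -/
theorem aug_word_of_ne_nil {w : List Rˣ} (hw : w ≠ []) : aug R (word R w) = 0 := by
  obtain ⟨a, w', rfl⟩ := List.exists_cons_of_ne_nil hw
  rw [word_cons, map_mul, aug_l, zero_mul]

/-- The monomials of length `≥ t` in the letters `l(a)`, `a ∈ L`, `L` a finite set of units. [cite: Milnor1970, §1 proof of Theorem 1.4, the clause for sums of generators (p0003 L49–L52)] -/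
def wordsFrom (L : Finset Rˣ) (t : ℕ) : Set (MilnorKStar R) :=
  {x | ∃ w : List Rˣ, (∀ a ∈ w, a ∈ L) ∧ t ≤ w.length ∧ word R w = x}

/-- The subgroup `S_t(L) ⊆ K_*R` generated by the monomials of length `≥ t` in the letters of `L` («linear combination of
monomials γ₁^{i₁}⋯γ_k^{i_k} with i₁ + ⋯ + i_k = s»). [cite: Milnor1970, §1 proof of Theorem 1.4, the clause for sums of generators (p0003 L49–L52)] -/
def wordSpan (L : Finset Rˣ) (t : ℕ) : AddSubgroup (MilnorKStar R) := AddSubgroup.closure (wordsFrom R L t)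

/-- A monomial of length `≥ t` in the letters of `L` lies in `S_t(L)`. [cite: Milnor1970, §1 proof of Theorem 1.4, the clause for sums of generators (p0003 L49–L52)] -/
theorem word_mem_wordSpan {L : Finset Rˣ} {t : ℕ} {w : List Rˣ} (hw : ∀ a ∈ w, a ∈ L) (ht : t ≤ w.length) :
    word R w ∈ wordSpan R L t :=
  AddSubgroup.subset_closure ⟨w, hw, ht, rfl⟩

/-- `1 ∈ S_0(L)`. [cite: Milnor1970, §1 proof of Theorem 1.4, the clause for sums of generators (p0003 L49–L52)] -/
theorem one_mem_wordSpan (L : Finset Rˣ) : (1 : MilnorKStar R) ∈ wordSpan R L 0 :=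
  word_mem_wordSpan R (w := []) (fun a ha => by simp at ha) le_rfl

/-- `S_t(L)` grows with `L` and shrinks with `t`. [cite: Milnor1970, §1 proof of Theorem 1.4, the clause for sums of generators (p0003 L49–L52)] -/
theorem wordSpan_mono {L L' : Finset Rˣ} (h : L ⊆ L') {t t' : ℕ} (ht : t' ≤ t) : wordSpan R L t ≤ wordSpan R L' t' := by
  refine AddSubgroup.closure_mono ?_
  rintro x ⟨w, hw, htw, rfl⟩
  exact ⟨w, fun a ha => h (hw a ha), ht.trans htw, rfl⟩

/-- **`S_t(L) · S_u(L) ⊆ S_{t+u}(L)`** («the power (γ₁ + ⋯ + γ_k)^s can be expressed as a linear combination of monomials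
[…] with i₁ + ⋯ + i_k = s»: products distribute over the generating monomials, which concatenate). [cite: Milnor1970, §1 proof of Theorem 1.4, the clause for sums of generators (p0003 L49–L52)] -/
theorem mul_mem_wordSpan {L : Finset Rˣ} {t u : ℕ} {x y : MilnorKStar R} (hx : x ∈ wordSpan R L t)
    (hy : y ∈ wordSpan R L u) : x * y ∈ wordSpan R L (t + u) := by
  -- reduce to generators on both sides through `comap` of the one-sided multiplications
  have key : ∀ v : List Rˣ, (∀ a ∈ v, a ∈ L) → u ≤ v.length →
      wordSpan R L t ≤ (wordSpan R L (t + u)).comap (AddMonoidHom.mulRight (word R v)) := by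
    intro v hv huv
    refine (AddSubgroup.closure_le _).2 ?_
    rintro z ⟨w, hw, htw, rfl⟩
    simp only [SetLike.mem_coe, AddSubgroup.mem_comap, AddMonoidHom.coe_mulRight, ← word_append]
    refine word_mem_wordSpan R (fun a ha => ?_) (by rw [List.length_append]; omega)
    rcases List.mem_append.1 ha with h | h
    exacts [hw a h, hv a h]
  have key2 : wordSpan R L u ≤ (wordSpan R L (t + u)).comap (AddMonoidHom.mulLeft x) := by
    refine (AddSubgroup.closure_le _).2 ?_
    rintro z ⟨v, hv, huv, rfl⟩
    have := key v hv huv hx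
    simp only [SetLike.mem_coe, AddSubgroup.mem_comap, AddMonoidHom.coe_mulRight, AddMonoidHom.coe_mulLeft] at this ⊢
    exact this
  have := key2 hy
  simp only [AddSubgroup.mem_comap, AddMonoidHom.coe_mulLeft] at this
  exact this

/-- **`x ∈ S_1(L) ⇒ x^t ∈ S_t(L)`**: the `t`-th power of a combination of monomials of positive length in the letters of `L`
is a combination of monomials of length `≥ t` in the same letters. [cite: Milnor1970, §1 proof of Theorem 1.4, the clause for sums of generators (p0003 L49–L52)] -/
theorem pow_mem_wordSpan {L : Finset Rˣ} {x : MilnorKStar R} (hx : x ∈ wordSpan R L 1) (t : ℕ) :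
    x ^ t ∈ wordSpan R L t := by
  induction t with
  | zero => rw [pow_zero]; exact one_mem_wordSpan R L
  | succ t ih => rw [pow_succ]; exact mul_mem_wordSpan R ih hx

/-- The class of `ι(y) ∈ T(K₁R)` is the one-letter monomial `l(y)`. [cite: Milnor1970, §1, the definition of K_*F (p0002 L5–L15)] -/
theorem mk_ι_eq_word (y : Additive Rˣ) :
    RingQuot.mkAlgHom ℤ (MilnorKStar.rel R) (TensorAlgebra.ι ℤ y) = word R [Additive.toMul y] := by
  rw [word_singleton]; rfl

/-- The scalars `ℤ = K₀R` lie in every `S_0(L)` (multiples of the empty monomial). [cite: Milnor1970, §1 «a graded ring K_*F = (K₀F, K₁F, K₂F, …)» (p0001 L31–L33)] -/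
theorem algebraMap_mem_wordSpan (L : Finset Rˣ) (c : ℤ) : algebraMap ℤ (MilnorKStar R) c ∈ wordSpan R L 0 := by
  rw [eq_intCast, ← zsmul_one]
  exact AddSubgroup.zsmul_mem _ (one_mem_wordSpan R L) c

/-- **Every element of `K_*R` is a `ℤ`-combination of monomials in finitely many letters** `l(a)`, `a ∈ L` («generated by
symbols l(a)»; induction over the tensor algebra, `RingQuot.mkAlgHom_surjective` and `TensorAlgebra.induction`). This is
the reduction «for any sum γ₁ + ⋯ + γ_k of generators» of the proof of Theorem 1.4. [cite: Milnor1970, §1, K_*F by generators and relations (p0002 L18–L20)] -/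
theorem exists_mem_wordSpan [DecidableEq Rˣ] (x : MilnorKStar R) : ∃ L : Finset Rˣ, x ∈ wordSpan R L 0 := by
  obtain ⟨t, rfl⟩ := RingQuot.mkAlgHom_surjective ℤ (MilnorKStar.rel R) x
  induction t using TensorAlgebra.induction with
  | algebraMap r => exact ⟨∅, by rw [AlgHom.commutes]; exact algebraMap_mem_wordSpan R ∅ r⟩
  | ι y =>
    refine ⟨{Additive.toMul y}, ?_⟩
    rw [mk_ι_eq_word]
    exact word_mem_wordSpan R (fun a ha => by simp only [List.mem_singleton] at ha; simp [ha]) (Nat.zero_le _)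
  | mul t₁ t₂ h₁ h₂ =>
    obtain ⟨L₁, hL₁⟩ := h₁
    obtain ⟨L₂, hL₂⟩ := h₂
    refine ⟨L₁ ∪ L₂, ?_⟩
    rw [map_mul]
    exact mul_mem_wordSpan R (t := 0) (u := 0) (wordSpan_mono R Finset.subset_union_left le_rfl hL₁)
      (wordSpan_mono R Finset.subset_union_right le_rfl hL₂)
  | add t₁ t₂ h₁ h₂ =>
    obtain ⟨L₁, hL₁⟩ := h₁
    obtain ⟨L₂, hL₂⟩ := h₂
    refine ⟨L₁ ∪ L₂, ?_⟩
    rw [map_add]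
    exact add_mem (wordSpan_mono R Finset.subset_union_left le_rfl hL₁)
      (wordSpan_mono R Finset.subset_union_right le_rfl hL₂)

/-- The degree-`0` part of an element of `S_0(L)` splits off: `x = y + c·1` with `y ∈ S_1(L)`, `c ∈ ℤ`. [cite: Milnor1970, §1 «a graded ring K_*F = (K₀F, K₁F, K₂F, …)» (p0001 L31–L33)] -/
theorem exists_eq_add_algebraMap {L : Finset Rˣ} {x : MilnorKStar R} (hx : x ∈ wordSpan R L 0) :
    ∃ y ∈ wordSpan R L 1, ∃ c : ℤ, x = y + algebraMap ℤ (MilnorKStar R) c := by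
  induction hx using AddSubgroup.closure_induction with
  | mem y hy =>
    obtain ⟨w, hw, -, rfl⟩ := hy
    by_cases hnil : w = []
    · subst hnil
      exact ⟨0, zero_mem _, 1, by rw [word_nil, map_one, zero_add]⟩
    · exact ⟨word R w, word_mem_wordSpan R hw (List.length_pos_of_ne_nil hnil), 0, by rw [map_zero, add_zero]⟩
  | zero => exact ⟨0, zero_mem _, 0, by rw [map_zero, add_zero]⟩
  | add y z _ _ hy hz =>
    obtain ⟨y₁, hy₁, c₁, rfl⟩ := hy
    obtain ⟨z₁, hz₁, c₂, rfl⟩ := hz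
    exact ⟨y₁ + z₁, add_mem hy₁ hz₁, c₁ + c₂, by rw [map_add, add_add_add_comm]⟩
  | neg y _ hy =>
    obtain ⟨y₁, hy₁, c₁, rfl⟩ := hy
    exact ⟨-y₁, neg_mem hy₁, -c₁, by rw [map_neg, neg_add]⟩

/-- **A positive-dimensional element of `S_0(L)` lies in `S_1(L)`**, i.e. is a combination of monomials of positive length
(«positive dimensional element» = «sum γ₁ + ⋯ + γ_k of generators» up to integer coefficients). [cite: Milnor1970, §1 proof of Theorem 1.4, the clause for sums of generators (p0003 L49–L52)] -/
theorem mem_wordSpan_one_of_aug_eq_zero {L : Finset Rˣ} {x : MilnorKStar R} (hx : x ∈ wordSpan R L 0)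
    (h0 : aug R x = 0) : x ∈ wordSpan R L 1 := by
  obtain ⟨y, hy, c, rfl⟩ := exists_eq_add_algebraMap R hx
  have hc : c = 0 := by
    rw [map_add, aug_algebraMap] at h0
    have hy0 : aug R y = 0 := by
      refine AddSubgroup.closure_induction (fun z hz => ?_) (map_zero _) (fun a b _ _ ha hb => ?_)
        (fun a _ ha => ?_) hy
      · obtain ⟨w, -, hw1, rfl⟩ := hz
        exact aug_word_of_ne_nil R (List.ne_nil_of_length_pos hw1)
      · rw [map_add, ha, hb, add_zero]
      · rw [map_neg, ha, neg_zero]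
    rwa [hy0, zero_add] at h0
  rwa [hc, map_zero, add_zero]

/-- If every monomial of length `≥ N` in the letters of `L` vanishes then `S_N(L) = 0`. [cite: Milnor1970, §1 proof of Theorem 1.4, the clause for sums of generators (p0003 L49–L52)] -/
theorem wordSpan_eq_bot {L : Finset Rˣ} {N : ℕ} (h : ∀ w : List Rˣ, (∀ a ∈ w, a ∈ L) → N ≤ w.length → word R w = 0) :
    wordSpan R L N = ⊥ := by
  rw [wordSpan, AddSubgroup.closure_eq_bot_iff]
  rintro x ⟨w, hw, hN, rfl⟩
  exact h w hw hN

/-! ### positive-dimensional elements -/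

/-- **The positive-dimensional part `⊕_{n ≥ 1} K_nR ⊆ K_*R`**: the subgroup generated by the images `ofDeg (K_nR)`,
`n ≥ 1` («positive dimensional element of K_*F»). [cite: Milnor1970, §1 Theorem 1.4 (p0003 L21–L23)] -/
def posDim : AddSubgroup (MilnorKStar R) := ⨆ n : ℕ, (ofDeg R (n + 1)).range

/-- Elements of `K_nR`, `n ≥ 1`, are positive-dimensional. [cite: Milnor1970, §1 Theorem 1.4 (p0003 L21–L23)] -/
theorem ofDeg_succ_mem_posDim {n : ℕ} (x : MilnorK R (n + 1)) : ofDeg R (n + 1) x ∈ posDim R :=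
  AddSubgroup.mem_iSup_of_mem n ⟨x, rfl⟩

/-- `l(a)` is positive-dimensional. [cite: Milnor1970, §1 Theorem 1.4 (p0003 L21–L23)] -/
theorem l_mem_posDim (a : Rˣ) : l R a ∈ posDim R := by
  rw [← ofDeg_one_symbol R (fun _ : Fin 1 => a)]; exact ofDeg_succ_mem_posDim R _

/-- Monomials of positive length are positive-dimensional: `S_1(L) ⊆ ⊕_{n ≥ 1} K_nR`. [cite: Milnor1970, §1 Theorem 1.4 (p0003 L21–L23)] -/
theorem wordSpan_one_le_posDim (L : Finset Rˣ) : wordSpan R L 1 ≤ posDim R := by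
  refine (AddSubgroup.closure_le _).2 ?_
  rintro x ⟨w, -, hw1, rfl⟩
  obtain ⟨a, w', rfl⟩ := List.exists_cons_of_ne_nil (List.ne_nil_of_length_pos hw1)
  rw [SetLike.mem_coe, word_eq_ofDeg]
  exact ofDeg_succ_mem_posDim R _

/-- **The positive-dimensional elements are exactly the kernel of the augmentation `K_*R → K₀R = ℤ`.** [cite: Milnor1970, §1 «a graded ring K_*F = (K₀F, K₁F, K₂F, …)» (p0001 L31–L33)] -/
theorem mem_posDim_iff [DecidableEq Rˣ] (x : MilnorKStar R) : x ∈ posDim R ↔ aug R x = 0 := by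
  refine ⟨fun hx => ?_, fun hx => ?_⟩
  · refine AddSubgroup.iSup_induction (C := fun y => aug R y = 0) _ hx (fun n y hy => ?_) (map_zero _)
      (fun y z hy hz => by rw [map_add, hy, hz, add_zero])
    obtain ⟨y', rfl⟩ := hy
    exact aug_ofDeg_succ R y'
  · obtain ⟨L, hL⟩ := exists_mem_wordSpan R x
    exact wordSpan_one_le_posDim R L (mem_wordSpan_one_of_aug_eq_zero R hL hx)

/-- **`K_*R` is generated by its homogeneous components**: the images of the `K_nR`, `n ≥ 0`, generate `K_*R` as a group
(«K_*F = (K₀F, K₁F, K₂F, …)»). [cite: Milnor1970, §1 «a graded ring K_*F = (K₀F, K₁F, K₂F, …)» (p0001 L31–L33)] -/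
theorem iSup_range_ofDeg [DecidableEq Rˣ] : (⨆ n : ℕ, (ofDeg R n).range) = ⊤ := by
  rw [eq_top_iff]
  intro x _
  obtain ⟨L, hL⟩ := exists_mem_wordSpan R x
  refine (AddSubgroup.closure_le _).2 ?_ hL
  rintro y ⟨w, -, -, rfl⟩
  rw [SetLike.mem_coe, word_eq_ofDeg]
  exact AddSubgroup.mem_iSup_of_mem w.length ⟨_, rfl⟩

end MilnorKStar

end Ring

/-! ### over a field: LEMMA 1.1 and LEMMA 1.2 in `K_*F`, and THEOREM 1.4 -/

section Field

variable (F : Type*) [Field F]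

namespace MilnorKStar

/-- `ε = l(−1) ∈ K_*F`. [cite: Milnor1970, §1 Lemma 1.2 «The identity l(a)² = l(a)l(−1) is valid for every l(a) ∈ K₁F» (p0002 L48–L50)] -/
def eps : MilnorKStar F := l F (-1)

/-- `ε = l(−1)`. [cite: Milnor1970, §1 Lemma 1.2 «The identity l(a)² = l(a)l(−1) is valid for every l(a) ∈ K₁F» (p0002 L48–L50)] -/
theorem eps_def : eps F = l F (-1) := rfl

/-- **«2 l(−1) = 0»** (`l(−1) + l(−1) = l(1) = 0`). [cite: Milnor1970, §1 proof of Theorem 1.4 «Since 2l(−1) = 0» (p0003 L46)] -/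
theorem eps_add_eps : eps F + eps F = 0 := by
  rw [eps, ← l_mul, neg_one_mul, neg_neg, l_one]

/-- `l(−1)x + l(−1)x = 0`. [cite: Milnor1970, §1 proof of Theorem 1.4 «Since 2l(−1) = 0» (p0003 L46)] -/
theorem eps_mul_add_eps_mul (x : MilnorKStar F) : eps F * x + eps F * x = 0 := by
  rw [← add_mul, eps_add_eps, zero_mul]

/-- `l(−1)` is positive-dimensional (`aug l(−1) = 0`). [cite: Milnor1970, §1 Theorem 1.4 (p0003 L21–L23)] -/
theorem aug_eps : aug F (eps F) = 0 := aug_l F _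

/-- `l(−1) ∈ ⊕_{n ≥ 1} K_nF`. [cite: Milnor1970, §1 Theorem 1.4 (p0003 L21–L23)] -/
theorem eps_mem_posDim : eps F ∈ posDim F := l_mem_posDim F _

/-- `finSucc 0 = 1` in `Fin 2`. [folklore] -/
private theorem finSucc_zero_two (h : (0 : Fin 2).val + 1 < 2) : finSucc (0 : Fin 2) h = 1 := rfl

/-- Swapping the two entries of a pair. [folklore] -/
private theorem vec2_comp_swap (a b : Fˣ) : ![a, b] ∘ Equiv.swap (0 : Fin 2) 1 = ![b, a] := by
  funext i
  fin_cases i <;> rfl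

/-- **LEMMA 1.1 in `K_*F`** (degree `1 × 1`): `l(a)l(b) + l(b)l(a) = 0` — transported from `K₂F` (`MilnorK.symbol_comp_swap`
of `MilnorKGroups`) along `ofDeg 2`. [cite: Milnor1970, §1 Lemma 1.1 «ηξ = (−1)^{mn} ξη», m = n = 1: «the sum l(a)l(b) + l(b)l(a) is equal to […] l(ab)l(−ab) = 0» (p0002 L33–L45)] -/
theorem l_mul_l_add (a b : Fˣ) : l F a * l F b + l F b * l F a = 0 := by
  have h : (0 : Fin 2).val + 1 < 2 := by decide
  have key := MilnorK.symbol_comp_swap ![a, b] 0 h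
  rw [finSucc_zero_two, vec2_comp_swap, eq_neg_iff_add_eq_zero] at key
  apply_fun ofDeg F 2 at key
  rw [map_add, map_zero, ofDeg_two_symbol, ofDeg_two_symbol] at key
  simpa [add_comm] using key

/-- **LEMMA 1.2 in `K_*F`**: `l(a)² = l(a)l(−1)` — transported from `K₂F` (`MilnorK.symbol_eq_of_eq_self`) along `ofDeg 2`.
[cite: Milnor1970, §1 Lemma 1.2 «The identity l(a)² = l(a)l(−1) is valid for every l(a) ∈ K₁F» (p0002 L48–L50)] -/
theorem l_mul_self (a : Fˣ) : l F a * l F a = l F a * eps F := by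
  have h : (0 : Fin 2).val + 1 < 2 := by decide
  have key := MilnorK.symbol_eq_of_eq_self ![a, a] 0 h rfl
  rw [finSucc_zero_two, MilnorK.update_vec2_one] at key
  apply_fun ofDeg F 2 at key
  rw [ofDeg_two_symbol, ofDeg_two_symbol] at key
  simpa [eps_def] using key

/-- `l(a)l(−1) = l(−1)l(a)` (Lemma 1.1 and `2l(−1) = 0`: `l(a)l(−1) = −l(−1)l(a) = l(−1)l(a)`). [cite: Milnor1970, §1 Lemma 1.1 (p0002 L33–L45)] -/
theorem l_mul_eps_comm (a : Fˣ) : l F a * eps F = eps F * l F a := by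
  have h1 : l F a * eps F + eps F * l F a = 0 := l_mul_l_add F a (-1)
  have h2 : eps F * l F a + eps F * l F a = 0 := eps_mul_add_eps_mul F _
  exact add_right_cancel (h1.trans h2.symm)

/-- LEMMA 1.2, left form: `l(a)² = l(−1)l(a)`. [cite: Milnor1970, §1 Lemma 1.2 «The identity l(a)² = l(a)l(−1) is valid for every l(a) ∈ K₁F» (p0002 L48–L50)] -/
theorem l_mul_self' (a : Fˣ) : l F a * l F a = eps F * l F a := by rw [l_mul_self, l_mul_eps_comm]

/-- **`l(−1)` is central in `K_*F`** (it commutes with the generators `l(a)` and with `K₀F = ℤ`). [cite: Milnor1970, §1 Lemma 1.1 (p0002 L33–L45)] -/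
theorem eps_comm (x : MilnorKStar F) : eps F * x = x * eps F := by
  obtain ⟨t, rfl⟩ := RingQuot.mkAlgHom_surjective ℤ (MilnorKStar.rel F) x
  induction t using TensorAlgebra.induction with
  | algebraMap r => rw [AlgHom.commutes]; exact (Algebra.commutes r (eps F)).symm
  | ι y => rw [mk_ι_eq_word, word_singleton]; exact (l_mul_eps_comm F (Additive.toMul y)).symm
  | mul t₁ t₂ h₁ h₂ => rw [map_mul, ← _root_.mul_assoc, h₁, _root_.mul_assoc, h₂, _root_.mul_assoc]
  | add t₁ t₂ h₁ h₂ => rw [map_add, mul_add, add_mul, h₁, h₂]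

/-- **«it follows from 1.2»**: if the letter `a` occurs in the monomial `w`, then `l(a)·w = l(−1)·w` (move `l(a)` next to its
twin by Lemma 1.1, contract `l(a)² = l(−1)l(a)` by Lemma 1.2, and move `l(−1)` to the front; all signs disappear because
`2l(−1) = 0`). [cite: Milnor1970, §1 proof of Theorem 1.4, the clause for sums of generators (p0003 L49–L52)] -/
theorem l_mul_word_of_mem {a : Fˣ} {w : List Fˣ} (ha : a ∈ w) : l F a * word F w = eps F * word F w := by
  induction w with
  | nil => simp at ha
  | cons b w ih =>
    by_cases hab : a = b
    · subst hab
      rw [word_cons, ← _root_.mul_assoc, l_mul_self', _root_.mul_assoc]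
    · have ih' := ih ((List.mem_cons.1 ha).resolve_left hab)
      -- `l a l b w + l b l a w = 0` and `l b l a w = l b ε w = ε (l b w)`, `ε y + ε y = 0`
      have h1 : l F a * word F (b :: w) + eps F * word F (b :: w) = 0 := by
        rw [word_cons, ← _root_.mul_assoc, ← _root_.mul_assoc, eps_comm F (l F b), _root_.mul_assoc (l F b),
          ← ih', ← _root_.mul_assoc, ← add_mul, l_mul_l_add, zero_mul]
      exact add_right_cancel (h1.trans (eps_mul_add_eps_mul F _).symm)

/-- A list in which `x` occurs twice splits as `u ++ x :: v` with `x ∈ v`. [folklore] -/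
private theorem exists_split_of_duplicate {α : Type*} {x : α} {l : List α} (h : List.Duplicate x l) :
    ∃ u v : List α, l = u ++ x :: v ∧ x ∈ v := by
  induction l with
  | nil => exact absurd h (List.not_duplicate_nil x)
  | cons y l ih =>
    rcases List.duplicate_cons_iff.1 h with ⟨rfl, hm⟩ | h'
    · exact ⟨[], l, rfl, hm⟩
    · obtain ⟨u, v, rfl, hv⟩ := ih h'
      exact ⟨y :: u, v, rfl, hv⟩

/-- **A monomial with a repeated letter is `l(−1)·` a monomial one letter shorter in the same letters.** [cite: Milnor1970, §1 proof of Theorem 1.4, the clause for sums of generators (p0003 L49–L52)] -/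
theorem word_of_not_nodup {w : List Fˣ} (hw : ¬ w.Nodup) :
    ∃ w' : List Fˣ, (∀ a ∈ w', a ∈ w) ∧ w'.length + 1 = w.length ∧ word F w = eps F * word F w' := by
  obtain ⟨a, ha⟩ := List.exists_duplicate_iff_not_nodup.2 hw
  obtain ⟨u, v, rfl, hav⟩ := exists_split_of_duplicate ha
  refine ⟨u ++ v, fun b hb => ?_, by simp only [List.length_append, List.length_cons]; omega, ?_⟩
  · rcases List.mem_append.1 hb with h | h
    · exact List.mem_append.2 (Or.inl h)
    · exact List.mem_append.2 (Or.inr (List.mem_cons_of_mem a h))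
  · rw [word_append, word_cons, l_mul_word_of_mem F hav, word_append, ← _root_.mul_assoc (word F u), ← eps_comm,
      _root_.mul_assoc]

/-- **«Choosing s > k, note that each such monomial is a multiple of l(−1)^{n(s−k)}»**: a monomial of length `≥ |L| + j` in
the letters of the finite set `L` equals `l(−1)^j ·` a monomial in the same letters (pigeonhole: more than `|L|` letters from
`L` repeat one). [cite: Milnor1970, §1 proof of Theorem 1.4, the clause for sums of generators (p0003 L49–L52)] -/
theorem word_eq_eps_pow_mul [DecidableEq Fˣ] (L : Finset Fˣ) (j : ℕ) :
    ∀ w : List Fˣ, (∀ a ∈ w, a ∈ L) → L.card + j ≤ w.length →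
      ∃ w' : List Fˣ, (∀ a ∈ w', a ∈ L) ∧ word F w = eps F ^ j * word F w' := by
  induction j with
  | zero => intro w hw _; exact ⟨w, hw, by rw [pow_zero, _root_.one_mul]⟩
  | succ j ih =>
    intro w hw hlen
    have hnd : ¬ w.Nodup := by
      intro hnd
      have h1 : w.toFinset.card = w.length := List.toFinset_card_of_nodup hnd
      have h2 : w.toFinset.card ≤ L.card := Finset.card_le_card fun a ha => hw a (List.mem_toFinset.1 ha)
      omega
    obtain ⟨w₁, hw₁, hlen₁, hk⟩ := word_of_not_nodup F hnd
    obtain ⟨w', hw', hk'⟩ := ih w₁ (fun a ha => hw a (hw₁ a ha)) (by omega)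
    refine ⟨w', hw', ?_⟩
    rw [hk, hk', ← _root_.mul_assoc, ← pow_succ']

/-- **«If s > k + r/n, it follows that (γ₁ + ⋯ + γ_k)^s = 0»**, monomial form: if `l(−1)^{r+1} = 0` then every monomial of
length `≥ |L| + r + 1` in the letters of `L` vanishes. [cite: Milnor1970, §1 proof of Theorem 1.4, the clause for sums of generators (p0003 L49–L52)] -/
theorem word_eq_zero_of_eps_pow [DecidableEq Fˣ] {r : ℕ} (hr : eps F ^ (r + 1) = 0) (L : Finset Fˣ) (w : List Fˣ)
    (hw : ∀ a ∈ w, a ∈ L) (hlen : L.card + (r + 1) ≤ w.length) : word F w = 0 := by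
  obtain ⟨w', -, hk⟩ := word_eq_eps_pow_mul F L (r + 1) w hw hlen
  rw [hk, hr, zero_mul]

/-- **«it follows immediately that l(−1)^{r+1} = 0»** in `K_*F` when `−1` is a sum of squares (from `K_{r+1}F`,
`MilnorK.exists_symbol_neg_one_eq_zero` of `MilnorKSumOfSquares`, along `ofDeg`). [cite: Milnor1970, §1 proof of Theorem
1.4 «Conversely, if say −1 = a₁² + ⋯ + a_r² […] it follows immediately that l(−1)^{r+1} = 0» (p0003 L43–L46)] -/
theorem exists_eps_pow_eq_zero (h : IsSumSq (-1 : F)) : ∃ r : ℕ, eps F ^ (r + 1) = 0 := by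
  obtain ⟨r, hr⟩ := MilnorK.exists_symbol_neg_one_eq_zero h
  exact ⟨r, by rw [eps, ← ofDeg_symbol_const, hr, map_zero]⟩

/-- **THEOREM 1.4, `⇒`: if `−1` is a sum of squares in `F`, then every positive-dimensional element of `K_*F` is
nilpotent** — `x` is a `ℤ`-combination of monomials of positive length in finitely many letters `L`
(`exists_mem_wordSpan`, `mem_wordSpan_one_of_aug_eq_zero`), `x^s ∈ S_s(L)` (`pow_mem_wordSpan`), and `S_s(L) = 0` for
`s ≥ |L| + r + 1` (`word_eq_zero_of_eps_pow`). [cite: Milnor1970, §1 proof of Theorem 1.4 (p0003 L24–L52)] -/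
theorem isNilpotent_of_aug_eq_zero (h : IsSumSq (-1 : F)) (x : MilnorKStar F) (hx : aug F x = 0) : IsNilpotent x := by
  classical
  obtain ⟨r, heps⟩ := exists_eps_pow_eq_zero F h
  obtain ⟨L, hL⟩ := exists_mem_wordSpan F x
  have hx1 := mem_wordSpan_one_of_aug_eq_zero F hL hx
  refine ⟨L.card + (r + 1), ?_⟩
  have hmem := pow_mem_wordSpan F hx1 (L.card + (r + 1))
  rw [wordSpan_eq_bot F (word_eq_zero_of_eps_pow F heps L)] at hmem
  exact (AddSubgroup.mem_bot).1 hmem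

/-! #### the sign character of an ordering: `l(−1)` is not nilpotent -/

/-- **The sign character of a total preordering `P`**: the ring homomorphism `K_*F → ℤ/2ℤ`, `l(a) ↦ (1 − sgn a)/2`
(`sgnBit` of `MilnorKSumOfSquares`), well defined because `a` and `1 − a` are never both negative
(`not_add_eq_one_of_not_mem`); it restricts on each `K_nF` to the `n`-linear invariant `signHomK` of that file. [cite: Milnor1970, §1 proof of Theorem 1.4 «define an n-linear mapping from K₁F × ⋯ × K₁F to the integers modulo 2 by the correspondence l(a₁) × ⋯ × l(aₙ) ↦ (1 − sgn a₁)/2 ⋯ (1 − sgn aₙ)/2 […] which carries l(−1)ⁿ to 1. This proves that the element l(−1) is not nilpotent» (p0003 L24–L43)] -/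
def signChar (P : RingPreordering F) (hP : ∀ a : F, a ∈ P ∨ -a ∈ P) : MilnorKStar F →ₐ[ℤ] ZMod 2 :=
  RingQuot.liftAlgHom ℤ ⟨TensorAlgebra.lift ℤ (sgnBitHom P hP).toIntLinearMap, by
    rintro x y ⟨a, b, hab, rfl, rfl⟩
    rw [map_mul, TensorAlgebra.lift_ι_apply, TensorAlgebra.lift_ι_apply, map_zero, AddMonoidHom.coe_toIntLinearMap,
      sgnBitHom_ofMul, sgnBitHom_ofMul]
    by_cases ha : (a : F) ∈ P
    · rw [sgnBit_of_mem ha, zero_mul]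
    · have hb : (b : F) ∈ P := by
        by_contra hb
        exact not_add_eq_one_of_not_mem hP ha hb hab
      rw [sgnBit_of_mem hb, mul_zero]⟩

/-- `signChar (l(a)) = (1 − sgn a)/2`. [cite: Milnor1970, §1 proof of Theorem 1.4, the sign invariant (p0003 L24–L43)] -/
theorem signChar_l (P : RingPreordering F) (hP : ∀ a : F, a ∈ P ∨ -a ∈ P) (a : Fˣ) :
    signChar F P hP (l F a) = sgnBit P a := by
  rw [l_def, signChar, RingQuot.liftAlgHom_mkAlgHom_apply, TensorAlgebra.lift_ι_apply, AddMonoidHom.coe_toIntLinearMap,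
    sgnBitHom_ofMul]

/-- **«which carries l(−1)ⁿ to 1»**: `signChar (l(−1)) = 1`. [cite: Milnor1970, §1 proof of Theorem 1.4, the sign invariant (p0003 L24–L43)] -/
theorem signChar_eps (P : RingPreordering F) (hP : ∀ a : F, a ∈ P ∨ -a ∈ P) : signChar F P hP (eps F) = 1 := by
  rw [eps, signChar_l, sgnBit_neg_one]

/-- **THEOREM 1.4, `⇐`: if `l(−1)` is nilpotent in `K_*F` then `−1` is a sum of squares** («If −1 is not a sum of
squares, then F […] can be ordered […] This proves that the element l(−1) is not nilpotent»: the ordering is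
`exists_total_ringPreordering` of `MilnorKSumOfSquares`, and `signChar (l(−1)^s) = 1 ≠ 0`). [cite: Milnor1970, §1 proof of Theorem 1.4, the sign invariant (p0003 L24–L43)] -/
theorem isSumSq_of_isNilpotent_eps (h : IsNilpotent (eps F)) : IsSumSq (-1 : F) := by
  by_contra hns
  obtain ⟨P, hP⟩ := exists_total_ringPreordering hns
  obtain ⟨s, hs⟩ := h
  have := congrArg (signChar F P hP) hs
  rw [map_pow, signChar_eps, one_pow, map_zero] at this
  exact one_ne_zero this

/-- **THEOREM 1.4 (Milnor 1970).** «The element −1 is a sum of squares in F if and only if every positive dimensional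
element of K_*F is nilpotent.»  Here `K_*F = MilnorKStar F` is Milnor's ring (the tensor algebra of `K₁F` modulo the
ideal generated by the `l(a) ⊗ l(1−a)`) and «positive dimensional» is read as lying in the kernel of the augmentation
`K_*F → K₀F = ℤ` (equivalently, by `mem_posDim_iff`, in the subgroup generated by the images of the `K_nF`, `n ≥ 1`:
`isSumSq_neg_one_iff_isNilpotent'`). [cite: Milnor1970, §1 Theorem 1.4 (p0003 L21–L23)] -/
theorem isSumSq_neg_one_iff_isNilpotent :
    IsSumSq (-1 : F) ↔ ∀ x : MilnorKStar F, aug F x = 0 → IsNilpotent x :=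
  ⟨fun h x hx => isNilpotent_of_aug_eq_zero F h x hx, fun h => isSumSq_of_isNilpotent_eps F (h _ (aug_eps F))⟩

/-- **THEOREM 1.4**, with «positive dimensional» read as membership in `⊕_{n ≥ 1} K_nF ⊆ K_*F` (`posDim`, the subgroup
generated by the images of the `K_nF`, `n ≥ 1`). [cite: Milnor1970, §1 Theorem 1.4 (p0003 L21–L23)] -/
theorem isSumSq_neg_one_iff_isNilpotent' :
    IsSumSq (-1 : F) ↔ ∀ x ∈ posDim F, IsNilpotent x := by
  classical
  simp only [mem_posDim_iff]
  exact isSumSq_neg_one_iff_isNilpotent F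

end MilnorKStar

end Field

end Literature.RingTheory.KTheory

end
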